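import Literature.NumberTheory.Automorphic.GL2CUpperHalfSpaceCalculus
import Literature.Analysis.Calculus.PoincareLemmaOneFormStarConvex
import HarnessLib

/-!
# Equivariant primitives of closed `𝔭`-cochains on `GL₂(ℂ)`

This is the analytic half of the degree-one van Est / Eichler–Shimura–Harder comparison for
Bianchi groups [cite: Harder1987, §3; BorelWallach2000, VII §2]: a *closed, `U(2)`-equivariant,
`A_G`-invariant* family `X ↦ f X : GL₂(ℂ) → V` of `V`-valued `C¹` functions indexed linearly by
the traceless Hermitian matrices `X ∈ 𝔭₀` (the tangent space of `ℍ³ = GL₂(ℂ)/ℂˣU(2)`) admits a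
`C¹` primitive `F : GL₂(ℂ) → V`, right-`U(2)`- and centre-invariant, with right derivatives
`R_X F = f X` for `X ∈ 𝔭₀` and `R_Y F = 0` along `𝔨 = 𝔲(2)` and the centre.

The construction: push the cochain down to the `V`-valued `1`-form
`ω_p(v) = (2r)⁻¹ f (X_v) (sec p)` on the upper half-space `{(z, r) | r > 0}` through the Iwasawa
section `sec` of `GL2CUpperHalfSpaceCalculus`; closedness of the cochain plus its infinitesimal
`U(2)`-equivariance make `ω` closed (`fderiv_formAt_symm`), the Poincaré lemma on the (convex)
half-space (`PoincareLemmaOneFormStarConvex`) gives a potential, and its pull-back along the orbit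
map `proj` is the primitive (`primitive`, `fderiv_primitive_mul`).

Everything here is elementary real analysis on `M₂(ℂ)`; no automorphic input. [folklore]
-/

noncomputable section

open Matrix Complex Set Filter
open scoped MatrixGroups ComplexConjugate Matrix.Norms.Operator Topology ContDiff Classical

namespace Literature.NumberTheory.Automorphic

namespace GL2C

variable {V : Type*} [NormedAddCommGroup V] [NormedSpace ℝ V]

/-! ### Traceless Hermitian matrices and equivariant closed cochains -/

/-- `X ∈ 𝔭₀`: `X` is Hermitian and traceless (the `−1`-eigenspace of the Cartan involution of
`𝔰𝔩₂(ℂ)` viewed as a real Lie algebra). [folklore] -/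
def IsHT (X : Mat) : Prop := Xᴴ = X ∧ X.trace = 0

/-- The model matrices `X_v` are traceless Hermitian. [folklore] -/
theorem isHT_Xof (v : ℂ × ℝ) : IsHT (Xof v) := ⟨conjTranspose_Xof v, trace_Xof v⟩

/-- `𝔭₀` is stable under `Ad U(2)`. [folklore] -/
theorem IsHT.conj {X : Mat} (hX : IsHT X) {k : Mat} (hk : k ∈ Matrix.unitaryGroup (Fin 2) ℂ) :
    IsHT (k * X * star k) := by
  refine ⟨?_, ?_⟩
  · rw [star_eq_conjTranspose, conjTranspose_mul, conjTranspose_mul, conjTranspose_conjTranspose,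
      hX.1, Matrix.mul_assoc]
  · rw [Matrix.trace_mul_cycle, Matrix.mem_unitaryGroup_iff'.1 hk, Matrix.one_mul, hX.2]

/-- `𝔭₀` is a real subspace: closed under real linear combinations. [folklore] -/
theorem IsHT.add {X Y : Mat} (hX : IsHT X) (hY : IsHT Y) : IsHT (X + Y) :=
  ⟨by rw [conjTranspose_add, hX.1, hY.1], by rw [trace_add, hX.2, hY.2, add_zero]⟩

/-- `𝔭₀` is a real subspace: closed under real scalars. [folklore] -/
theorem IsHT.smul {X : Mat} (hX : IsHT X) (a : ℝ) : IsHT (a • X) :=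
  ⟨by rw [conjTranspose_smul, hX.1, star_trivial], by rw [trace_smul, hX.2, smul_zero]⟩

/-- The commutator of a skew-Hermitian and a traceless Hermitian matrix is traceless Hermitian
(`[𝔨, 𝔭] ⊆ 𝔭`). [folklore] -/
theorem IsHT.bracket {X Y : Mat} (hX : IsHT X) (hY : Yᴴ = -Y) : IsHT (Y * X - X * Y) := by
  refine ⟨?_, ?_⟩
  · rw [conjTranspose_sub, conjTranspose_mul, conjTranspose_mul, hX.1, hY]
    simp only [Matrix.mul_neg, Matrix.neg_mul, sub_neg_eq_add]
    abel
  · rw [trace_sub, Matrix.trace_mul_comm, sub_self]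

/-- **Closed equivariant `𝔭`-cochains.**  `f : 𝔭₀ → C¹(GL₂(ℂ), V)` (extended linearly to all of
`M₂(ℂ)`; only its values on `𝔭₀` matter) is
* `C¹` on the invertible matrices;
* *closed*: `R_X (f Y) = R_Y (f X)` for `X, Y ∈ 𝔭₀` (the degree-one differential of the relative
  `(𝔤, K)`-complex, `[𝔭, 𝔭] ⊆ 𝔨`);
* `U(2)`-*equivariant*: `f (Ad(k) X) (M) = f X (M k)`;
* invariant under the connected centre `A_G = ℝ_{>0}`.
These are exactly the properties of `X ↦ (g ↦ ρ(g) η(X)(g))` for a `K`-equivariant closed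
`1`-cochain `η ∈ Hom_K(𝔭, W ⊗ V)` of `A_G`-invariant automorphic forms.
[cite: BorelWallach2000, I §1.2 and VII §2.2] -/
structure IsCochain (f : Mat →ₗ[ℝ] (Mat → V)) : Prop where
  contDiffOn : ∀ X, IsHT X → ContDiffOn ℝ 1 (f X) Inv
  closed : ∀ X Y, IsHT X → IsHT Y → ∀ M ∈ Inv,
    fderiv ℝ (f Y) M (M * X) = fderiv ℝ (f X) M (M * Y)
  equivariant : ∀ k ∈ Matrix.unitaryGroup (Fin 2) ℂ, ∀ X, IsHT X → ∀ M ∈ Inv,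
    f (k * X * star k) M = f X (M * k)
  central : ∀ r : ℝ, 0 < r → ∀ X, IsHT X → ∀ M ∈ Inv, f X ((r : ℂ) • M) = f X M

/-- `M ↦ Mᴴ` is continuous for the operator-norm (`Matrix.Norms.Operator`) topology on `M₂(ℂ)`
used throughout: Mathlib's instance is keyed to the product topology, which agrees with this one
definitionally but not reducibly, so instance search needs this restatement. [folklore] -/
instance instContinuousStarMatOp : @ContinuousStar Mat
      (@UniformSpace.toTopologicalSpace Mat (@PseudoMetricSpace.toUniformSpace Mat
        (@SeminormedRing.toPseudoMetricSpace Mat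
          (@NormedRing.toSeminormedRing Mat Matrix.linftyOpNormedRing)))) inferInstance :=
  ⟨continuous_star (R := Mat)⟩

variable {f : Mat →ₗ[ℝ] (Mat → V)}

/-- Pointwise linearity of the cochain in `X`. [folklore] -/
theorem coch_add (f : Mat →ₗ[ℝ] (Mat → V)) (X Y M : Mat) : f (X + Y) M = f X M + f Y M := by
  rw [map_add, Pi.add_apply]

/-- Pointwise linearity of the cochain in `X`. [folklore] -/
theorem coch_smul (f : Mat →ₗ[ℝ] (Mat → V)) (a : ℝ) (X M : Mat) : f (a • X) M = a • f X M := by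
  rw [map_smul, Pi.smul_apply]

/-- Pointwise linearity of the cochain in `X`. [folklore] -/
theorem coch_sub (f : Mat →ₗ[ℝ] (Mat → V)) (X Y M : Mat) : f (X - Y) M = f X M - f Y M := by
  rw [map_sub, Pi.sub_apply]

/-- Pointwise linearity of the cochain in `X`. [folklore] -/
theorem coch_neg (f : Mat →ₗ[ℝ] (Mat → V)) (X M : Mat) : f (-X) M = -f X M := by
  rw [map_neg, Pi.neg_apply]

/-- Evaluation at `M` composed with the cochain, as a continuous linear map `M₂(ℂ) →L[ℝ] V`.
[folklore] -/
def evalCLM (f : Mat →ₗ[ℝ] (Mat → V)) (M : Mat) : Mat →L[ℝ] V :=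
  LinearMap.toContinuousLinearMap ((LinearMap.proj M).comp f)

/-- Unfolding `evalCLM`. [folklore] -/
@[simp] theorem evalCLM_apply (f : Mat →ₗ[ℝ] (Mat → V)) (M X : Mat) :
    evalCLM f M X = f X M := rfl

/-- The one-parameter unitary group `t ↦ exp(tY)` of a skew-Hermitian `Y`. [folklore] -/
theorem exp_smul_mem_unitaryGroup {Y : Mat} (hY : Yᴴ = -Y) (t : ℝ) :
    NormedSpace.exp (t • Y) ∈ Matrix.unitaryGroup (Fin 2) ℂ := by
  refine NormedSpace.exp_mem_unitary_of_mem_skewAdjoint ?_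
  rw [skewAdjoint.mem_iff, star_eq_conjTranspose, conjTranspose_smul, hY, star_trivial, smul_neg]

/-- `d/dt exp(tY) = Y` at `t = 0`. [folklore] -/
theorem hasDerivAt_exp_smul_zero (Y : Mat) :
    HasDerivAt (fun t : ℝ => NormedSpace.exp (t • Y)) Y 0 := by
  have h := hasDerivAt_exp_smul_const' (𝕂 := ℝ) Y (0 : ℝ)
  rwa [zero_smul, NormedSpace.exp_zero, mul_one] at h

namespace IsCochain

/-- The components of a cochain are differentiable at invertible matrices. [folklore] -/
theorem differentiableAt (hf : IsCochain f) {X : Mat} (hX : IsHT X) {M : Mat} (hM : M ∈ Inv) :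
    DifferentiableAt ℝ (f X) M :=
  ((hf.contDiffOn X hX).differentiableOn (by simp)).differentiableAt (isOpen_Inv.mem_nhds hM)

/-- **Infinitesimal equivariance.**  Differentiating `f (k_t X k_t⋆) (M) = f X (M k_t)` along the
unitary one-parameter group `k_t = exp(tY)`, `Y ∈ 𝔲(2)`:
`R_Y (f X) (M) = f ([Y, X]) (M)`. [cite: BorelWallach2000, I §1.2] -/
theorem fderiv_mul_skewHerm (hf : IsCochain f) {X Y : Mat} (hX : IsHT X) (hY : Yᴴ = -Y)
    {M : Mat} (hM : M ∈ Inv) :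
    fderiv ℝ (f X) M (M * Y) = f (Y * X - X * Y) M := by
  set k : ℝ → Mat := fun t => NormedSpace.exp (t • Y) with hk
  have hkd : HasDerivAt k Y 0 := hasDerivAt_exp_smul_zero Y
  have hk0 : k 0 = 1 := by simp [k]
  -- right-hand side: `t ↦ f X (M k_t)`
  have h1 : HasDerivAt (fun t => f X (M * k t)) (fderiv ℝ (f X) M (M * Y)) 0 := by
    have hc : HasDerivAt (fun t => M * k t) (M * Y) 0 := hkd.const_mul M
    exact (hf.differentiableAt hX hM).hasFDerivAt.comp_hasDerivAt_of_eq 0 hc (by simp [hk0])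
  -- left-hand side: `t ↦ f (k_t X k_t⋆) M`
  have h2 : HasDerivAt (fun t => f (k t * X * star (k t)) M) (f (Y * X - X * Y) M) 0 := by
    have hc : HasDerivAt (fun t => k t * X * star (k t)) (Y * X - X * Y) 0 := by
      have h := (hkd.mul_const X).mul hkd.star
      simp only [hk0, star_one, mul_one, Matrix.one_mul, star_eq_conjTranspose, hY,
        Matrix.mul_neg, ← sub_eq_add_neg] at h
      exact h
    exact (evalCLM f M).hasFDerivAt.comp_hasDerivAt (0 : ℝ) hc
  have h2' : HasDerivAt (fun t => f X (M * k t)) (f (Y * X - X * Y) M) 0 := by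
    refine h2.congr_of_eventuallyEq (Eventually.of_forall fun t => ?_)
    exact (hf.equivariant (k t) (exp_smul_mem_unitaryGroup hY t) X hX M hM).symm
  exact h1.unique h2'

end IsCochain

/-! ### The closed `1`-form on the upper half-space -/

/-- The coefficient `p ↦ (2r)⁻¹ • f X (sec p)` of the pushed-down form. [folklore] -/
theorem contDiffOn_coef (hf : IsCochain f) {X : Mat} (hX : IsHT X) :
    ContDiffOn ℝ 1 (fun q : ℂ × ℝ => ((2 * q.2)⁻¹ : ℝ) • f X (sec q)) {p : ℂ × ℝ | 0 < p.2} := by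
  refine ContDiffOn.smul ?_ ?_
  · refine (contDiffOn_const.mul contDiff_snd.contDiffOn).inv fun p hp => ?_
    exact mul_ne_zero two_ne_zero (ne_of_gt hp)
  · refine (hf.contDiffOn X hX).comp (contDiffOn_sec.of_le (by exact_mod_cast le_top)) ?_
    exact fun p hp => isUnit_det_sec hp

/-- The derivative of the coefficient `p ↦ (2r)⁻¹ • f X (sec p)` (product and chain rules, with
`D sec = sec · frame`). [folklore] -/
theorem hasFDerivAt_coef (hf : IsCochain f) {X : Mat} (hX : IsHT X) {p : ℂ × ℝ} (hp : 0 < p.2) :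
    HasFDerivAt (fun q : ℂ × ℝ => ((2 * q.2)⁻¹ : ℝ) • f X (sec q))
      (((2 * p.2)⁻¹ : ℝ) • (fderiv ℝ (f X) (sec p)).comp (secDeriv p) +
        ((-(2 * 1) / (2 * p.2) ^ 2) • ContinuousLinearMap.snd ℝ ℂ ℝ).smulRight
          (f X (sec p))) p := by
  have h2 : HasDerivAt (fun r : ℝ => (2 * r)⁻¹) (-(2 * 1) / (2 * p.2) ^ 2) p.2 :=
    ((hasDerivAt_id p.2).const_mul 2).inv (mul_ne_zero two_ne_zero hp.ne')
  have hc : HasFDerivAt (fun q : ℂ × ℝ => (2 * q.2)⁻¹)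
      ((-(2 * 1) / (2 * p.2) ^ 2) • ContinuousLinearMap.snd ℝ ℂ ℝ) p :=
    h2.comp_hasFDerivAt p hasFDerivAt_snd
  have hg : HasFDerivAt (fun q => f X (sec q)) ((fderiv ℝ (f X) (sec p)).comp (secDeriv p)) p :=
    (hf.differentiableAt hX (isUnit_det_sec hp)).hasFDerivAt.comp p (hasFDerivAt_sec hp)
  exact hc.smul hg

/-- The derivative of the coefficient, evaluated:
`D_v ((2r)⁻¹ f X (sec p)) = −(v_r / 2r²) f X (sec p) + (2r)⁻¹ D(f X)(sec p)(sec p · frame_p v)`.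
[folklore] -/
theorem fderiv_coef_apply (hf : IsCochain f) {X : Mat} (hX : IsHT X) {p : ℂ × ℝ} (hp : 0 < p.2)
    (v : ℂ × ℝ) :
    fderiv ℝ (fun q : ℂ × ℝ => ((2 * q.2)⁻¹ : ℝ) • f X (sec q)) p v =
      -(v.2 / (2 * p.2 ^ 2)) • f X (sec p) +
        ((2 * p.2)⁻¹ : ℝ) • fderiv ℝ (f X) (sec p) (sec p * frame p v) := by
  rw [(hasFDerivAt_coef hf hX hp).fderiv]
  simp only [_root_.add_apply, _root_.smul_apply,
    ContinuousLinearMap.comp_apply, secDeriv_apply, ContinuousLinearMap.smulRight_apply,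
    ContinuousLinearMap.coe_snd', smul_eq_mul]
  rw [add_comm]
  congr 1
  congr 1
  have hr : p.2 ≠ 0 := hp.ne'
  field_simp

/-- **The pushed-down `1`-form** `ω_p(v) = (2r)⁻¹ • f (X_v) (sec p)` on `ℂ × ℝ ⊃ {r > 0}`:
the pull-back of the cochain along the Iwasawa section, in the coordinates `v ↦ X_v` of `𝔭₀`
(`D sec_p (v) = sec p · (2r)⁻¹ (X_v + Y_v)`, and the `𝔨`-component `Y_v` is invisible to an
equivariant primitive). [cite: Harder1987, §3.1] -/
def formAt (f : Mat →ₗ[ℝ] (Mat → V)) (p : ℂ × ℝ) : ℂ × ℝ →L[ℝ] V :=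
  ((2 * p.2)⁻¹ : ℝ) • (evalCLM f (sec p)).comp XofCLM

/-- Unfolding `formAt`. [folklore] -/
@[simp] theorem formAt_apply (f : Mat →ₗ[ℝ] (Mat → V)) (p v : ℂ × ℝ) :
    formAt f p v = ((2 * p.2)⁻¹ : ℝ) • f (Xof v) (sec p) := rfl

/-- `ω` is `C¹` on the half-space. [folklore] -/
theorem contDiffOn_formAt (hf : IsCochain f) :
    ContDiffOn ℝ 1 (formAt f) {p : ℂ × ℝ | 0 < p.2} := by
  refine contDiffOn_clm_apply.2 fun v => ?_
  simp only [formAt_apply]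
  exact contDiffOn_coef hf (isHT_Xof v)

/-- `ω` is differentiable at points of the half-space. [folklore] -/
theorem differentiableAt_formAt (hf : IsCochain f) {p : ℂ × ℝ} (hp : 0 < p.2) :
    DifferentiableAt ℝ (formAt f) p :=
  ((contDiffOn_formAt hf).differentiableOn (by simp)).differentiableAt
    (UpperHalfSpace.isOpen_halfSpace.mem_nhds hp)

/-- `Dω_p(v)(w) = D_v (p ↦ ω_p(w))`. [folklore] -/
theorem fderiv_formAt_apply_apply (hf : IsCochain f) {p : ℂ × ℝ} (hp : 0 < p.2) (v w : ℂ × ℝ) :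
    fderiv ℝ (formAt f) p v w =
      fderiv ℝ (fun q : ℂ × ℝ => ((2 * q.2)⁻¹ : ℝ) • f (Xof w) (sec q)) p v := by
  have h : fderiv ℝ (fun q => formAt f q w) p = (fderiv ℝ (formAt f) p).flip w := by
    rw [fderiv_clm_apply (differentiableAt_formAt hf hp) (differentiableAt_const w)]
    simp
  have e := congrArg (fun L : ℂ × ℝ →L[ℝ] V => L v) h
  simp only [ContinuousLinearMap.flip_apply] at e
  rw [← e]
  rfl

/-- **The derivative of `ω`**: with `s = sec p`,
`Dω_p(v)(w) = −(v_r/2r²) f X_w (s) + (2r)⁻² (D(f X_w)(s)(s X_v) + f [Y_v, X_w] (s))`,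
using infinitesimal equivariance for the `𝔨`-component `s Y_v` of `D sec_p(v)`.
[cite: Harder1987, §3.1] -/
theorem fderiv_formAt_eq (hf : IsCochain f) {p : ℂ × ℝ} (hp : 0 < p.2) (v w : ℂ × ℝ) :
    fderiv ℝ (formAt f) p v w =
      -(v.2 / (2 * p.2 ^ 2)) • f (Xof w) (sec p) +
        (((2 * p.2)⁻¹ : ℝ) * (2 * p.2)⁻¹) •
          (fderiv ℝ (f (Xof w)) (sec p) (sec p * Xof v) +
            f (Yof v * Xof w - Xof w * Yof v) (sec p)) := by
  rw [fderiv_formAt_apply_apply hf hp, fderiv_coef_apply hf (isHT_Xof w) hp v, frame,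
    Matrix.mul_smul, map_smul, Matrix.mul_add, map_add,
    hf.fderiv_mul_skewHerm (isHT_Xof w) (conjTranspose_Yof v) (isUnit_det_sec hp), smul_smul]

/-- The `𝔰𝔩₂(ℂ)` identity behind the closedness of `ω`:
`−2 v_r X_w + [Y_v, X_w]` is symmetric in `(v, w)`. [folklore] -/
theorem bracket_identity (v w : ℂ × ℝ) :
    -(2 * v.2) • Xof w + (Yof v * Xof w - Xof w * Yof v) =
      -(2 * w.2) • Xof v + (Yof w * Xof v - Xof v * Yof w) := by
  ext i j
  fin_cases i <;> fin_cases j <;> simp [Xof, Yof] <;> ring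

/-- **`ω` is closed**: `Dω_p(v)(w) = Dω_p(w)(v)`, from the closedness of the cochain on `𝔭₀`,
its infinitesimal `U(2)`-equivariance and `bracket_identity`. [cite: Harder1987, §3.1] -/
theorem fderiv_formAt_symm (hf : IsCochain f) {p : ℂ × ℝ} (hp : 0 < p.2) (v w : ℂ × ℝ) :
    fderiv ℝ (formAt f) p v w = fderiv ℝ (formAt f) p w v := by
  rw [fderiv_formAt_eq hf hp v w, fderiv_formAt_eq hf hp w v,
    hf.closed (Xof v) (Xof w) (isHT_Xof v) (isHT_Xof w) _ (isUnit_det_sec hp)]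
  have key := congrArg (fun Z => f Z (sec p)) (bracket_identity v w)
  simp only [coch_add, coch_smul, coch_sub] at key
  -- isolate `f (Y_v X_w - X_w Y_v) (sec p)`
  have key' : f (Yof v * Xof w - Xof w * Yof v) (sec p) =
      -(2 * w.2) • f (Xof v) (sec p) + f (Yof w * Xof v - Xof v * Yof w) (sec p) +
        (2 * v.2) • f (Xof w) (sec p) := by
    rw [coch_sub, coch_sub, ← key]
    module
  simp only [coch_sub] at key' ⊢
  rw [key']
  match_scalars <;> ring

/-! ### The potential on the half-space and the primitive on `GL₂(ℂ)` -/

/-- The half-space `{r > 0} ⊆ ℂ × ℝ` is convex. [folklore] -/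
theorem convex_halfSpace : Convex ℝ {p : ℂ × ℝ | 0 < p.2} :=
  convex_halfSpace_gt (LinearMap.snd ℝ ℂ ℝ).isLinear 0

/-- **The potential** of `ω`: its radial integral from the base point `j = (0, 1)`.
[cite: Harder1987, §3.1] -/
def potential (f : Mat →ₗ[ℝ] (Mat → V)) (p : ℂ × ℝ) : V :=
  ∫ t in (0 : ℝ)..1, formAt f (((0 : ℂ), (1 : ℝ)) + t • (p - ((0 : ℂ), (1 : ℝ))))
    (p - ((0 : ℂ), (1 : ℝ)))

/-- **The primitive** `F = potential ∘ proj : M₂(ℂ) → V` of the cochain.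
[cite: Harder1987, §3.1] -/
def primitive (f : Mat →ₗ[ℝ] (Mat → V)) (M : Mat) : V := potential f (proj M)

/-- `F` is right-`U(2)`-invariant. [folklore] -/
theorem primitive_mul_of_mem_unitaryGroup (f : Mat →ₗ[ℝ] (Mat → V)) {M k : Mat} (hM : M ∈ Inv)
    (hk : k ∈ Matrix.unitaryGroup (Fin 2) ℂ) : primitive f (M * k) = primitive f M := by
  simp only [primitive, proj_mul_of_mem_unitaryGroup hM hk]

/-- `F` is invariant under the centre. [folklore] -/
theorem primitive_smul (f : Mat →ₗ[ℝ] (Mat → V)) {M : Mat} (hM : M ∈ Inv) {c : ℂ} (hc : c ≠ 0) :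
    primitive f (c • M) = primitive f M := by
  simp only [primitive, proj_smul hM hc]

variable [CompleteSpace V]

/-- `D potential = ω` on the half-space (Poincaré lemma on the convex half-space).
[cite: Harder1987, §3.1] -/
theorem hasFDerivAt_potential (hf : IsCochain f) {p : ℂ × ℝ} (hp : 0 < p.2) :
    HasFDerivAt (potential f) (formAt f p) p :=
  Literature.Analysis.Calculus.hasFDerivAt_radialIntegral_of_starConvex
    UpperHalfSpace.isOpen_halfSpace (convex_halfSpace.starConvex (by simp))
    (contDiffOn_formAt hf) (fun _ hz v w => fderiv_formAt_symm hf hz v w) hp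

/-- The potential is `C¹` on the half-space. [folklore] -/
theorem contDiffOn_potential (hf : IsCochain f) :
    ContDiffOn ℝ 1 (potential f) {p : ℂ × ℝ | 0 < p.2} :=
  Literature.Analysis.Calculus.contDiffOn_one_radialIntegral_of_starConvex
    UpperHalfSpace.isOpen_halfSpace (convex_halfSpace.starConvex (by simp))
    (contDiffOn_formAt hf) (fun _ hz v w => fderiv_formAt_symm hf hz v w)

/-- `F` is differentiable at invertible matrices, with `DF(M) = ω_{proj M} ∘ D proj(M)`.
[folklore] -/
theorem hasFDerivAt_primitive (hf : IsCochain f) {M : Mat} (hM : M ∈ Inv) :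
    HasFDerivAt (primitive f) ((formAt f (proj M)).comp (fderiv ℝ proj M)) M :=
  (hasFDerivAt_potential hf (proj_snd_pos M)).comp M (differentiableAt_proj hM).hasFDerivAt

/-- `F` is `C¹` on the invertible matrices. [folklore] -/
theorem contDiffOn_primitive (hf : IsCochain f) : ContDiffOn ℝ 1 (primitive f) Inv :=
  (contDiffOn_potential hf).comp (contDiffOn_proj.of_le (by exact_mod_cast le_top))
    fun M _ => proj_snd_pos M

/-- **The right derivatives of the primitive along `𝔭₀`**: `R_X F (M) = f X (M)` for `M`
invertible and `X` traceless Hermitian.  Proof: write `M = s (c k)` (Iwasawa), so that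
`M (1 + tX) = c · s (1 + t X') k` with `X' = k X k⋆ ∈ 𝔭₀`; by the invariances of `proj`,
`F(M(1 + tX)) = potential (proj (s (1 + tX')))`, whose derivative at `0` is
`ω_p(r · tangentMap X') = ω_p(2r · vof X') = f X' (s) = f X (s k) = f X (M)`.
[cite: Harder1987, §3.1; BorelWallach2000, VII §2.2] -/
theorem fderiv_primitive_mul (hf : IsCochain f) {M : Mat} (hM : M ∈ Inv) {X : Mat} (hX : IsHT X) :
    fderiv ℝ (primitive f) M (M * X) = f X M := by
  obtain ⟨c, k, hc, hk, hMeq⟩ := exists_eq_sec_mul_smul (M := M) hM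
  set p : ℂ × ℝ := proj M with hp_def
  have hp : 0 < p.2 := proj_snd_pos M
  have hkk : star k * k = 1 := Matrix.mem_unitaryGroup_iff'.1 hk
  set X' : Mat := k * X * star k with hX'_def
  have hX' : IsHT X' := hX.conj hk
  have hs : sec p ∈ Inv := isUnit_det_sec hp
  -- (a) the derivative of `F ∘ (t ↦ M (1 + tX))` at `0` is `DF(M)(M X)`
  have hγ : HasDerivAt (fun t : ℝ => M * ((1 : Mat) + t • X)) (M * X) 0 := by
    have h := (hasDerivAt_id (0 : ℝ)).smul_const X
    rw [one_smul] at h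
    exact (h.const_add (1 : Mat)).const_mul M
  have hA : HasDerivAt (fun t : ℝ => primitive f (M * ((1 : Mat) + t • X)))
      (fderiv ℝ (primitive f) M (M * X)) 0 :=
    (hasFDerivAt_primitive hf hM).differentiableAt.hasFDerivAt.comp_hasDerivAt_of_eq 0 hγ
      (by simp)
  -- (b) the same curve read through the Iwasawa section
  have hB : HasDerivAt (fun t : ℝ => potential f (proj (sec p * ((1 : Mat) + t • X'))))
      (formAt f p ((p.2 : ℂ) * (tangentMap X').1, p.2 * (tangentMap X').2)) 0 :=
    (hasFDerivAt_potential hf hp).comp_hasDerivAt_of_eq 0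
      (hasDerivAt_proj_sec_mul_one_add_smul hp X') (by simp [proj_sec hp])
  have heq : (fun t : ℝ => primitive f (M * ((1 : Mat) + t • X))) =ᶠ[𝓝 0]
      fun t => potential f (proj (sec p * ((1 : Mat) + t • X'))) := by
    have hcont : Continuous fun t : ℝ => (1 : Mat) + t • X' := by fun_prop
    have h0 : (1 : Mat) + (0 : ℝ) • X' ∈ Inv := by simp
    filter_upwards [hcont.continuousAt.preimage_mem_nhds (isOpen_Inv.mem_nhds h0)] with t ht
    have ht' : (1 : Mat) + t • X' ∈ Inv := ht
    have hkX : k * ((1 : Mat) + t • X) = ((1 : Mat) + t • X') * k := by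
      simp only [hX'_def, Matrix.mul_add, Matrix.add_mul, Matrix.mul_one, Matrix.one_mul,
        Matrix.mul_smul, Matrix.smul_mul, Matrix.mul_assoc, hkk]
    have hMt : M * ((1 : Mat) + t • X) = (c : ℂ) • (sec p * ((1 : Mat) + t • X') * k) := by
      rw [hMeq, Matrix.mul_assoc, Matrix.smul_mul, hkX, Matrix.mul_smul, ← Matrix.mul_assoc]
    have hu1 : sec p * ((1 : Mat) + t • X') ∈ Inv := mul_mem_Inv hs ht'
    have hu2 : sec p * ((1 : Mat) + t • X') * k ∈ Inv :=
      mul_mem_Inv hu1 (mem_Inv_of_mem_unitaryGroup hk)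
    show potential f (proj (M * (1 + t • X))) = potential f (proj (sec p * (1 + t • X')))
    rw [hMt, proj_smul hu2 (ofReal_ne_zero.2 hc.ne'), proj_mul_of_mem_unitaryGroup hu1 hk]
  -- (c) compare and evaluate `ω_p` on the tangent vector
  rw [hA.unique (hB.congr_of_eventuallyEq heq), tangentMap_of_isHerm hX'.1 hX'.2]
  have hu : (((p.2 : ℂ) * ((2 : ℝ) • vof X').1, p.2 * ((2 : ℝ) • vof X').2) : ℂ × ℝ) =
      (2 * p.2) • vof X' := by
    ext
    · simp only [Prod.smul_fst, Complex.real_smul]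
      push_cast
      ring
    · simp only [Prod.smul_snd, smul_eq_mul]
      ring
  rw [hu, formAt_apply, Xof_smul, coch_smul, smul_smul,
    inv_mul_cancel₀ (mul_ne_zero two_ne_zero hp.ne'), one_smul, Xof_vof hX'.1 hX'.2, hX'_def,
    hf.equivariant k hk X hX (sec p) hs]
  conv_rhs => rw [hMeq, Matrix.mul_smul]
  exact (hf.central c hc X hX _ (mul_mem_Inv hs (mem_Inv_of_mem_unitaryGroup hk))).symm

/-- **The right derivatives of the primitive along `𝔨 = 𝔲(2)` vanish** (`F` is right
`U(2)`-invariant). [folklore] -/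
theorem fderiv_primitive_mul_skewHerm (hf : IsCochain f) {M : Mat} (hM : M ∈ Inv) {Y : Mat}
    (hY : Yᴴ = -Y) : fderiv ℝ (primitive f) M (M * Y) = 0 := by
  set k : ℝ → Mat := fun t => NormedSpace.exp (t • Y) with hk
  have hkd : HasDerivAt k Y 0 := hasDerivAt_exp_smul_zero Y
  have hA : HasDerivAt (fun t => primitive f (M * k t)) (fderiv ℝ (primitive f) M (M * Y)) 0 :=
    (hasFDerivAt_primitive hf hM).differentiableAt.hasFDerivAt.comp_hasDerivAt_of_eq 0
      (hkd.const_mul M) (by simp [k])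
  have hconst : (fun t => primitive f (M * k t)) = fun _ => primitive f M :=
    funext fun t => primitive_mul_of_mem_unitaryGroup f hM (exp_smul_mem_unitaryGroup hY t)
  rw [hconst] at hA
  exact hA.unique (hasDerivAt_const 0 _)

/-- **The derivative of the primitive along the real centre vanishes** (`F` is invariant under
`A_G`). [folklore] -/
theorem fderiv_primitive_self (hf : IsCochain f) {M : Mat} (hM : M ∈ Inv) :
    fderiv ℝ (primitive f) M M = 0 := by
  have hγ : HasDerivAt (fun t : ℝ => M + t • M) M 0 := by
    have h := (hasDerivAt_id (0 : ℝ)).smul_const M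
    rw [one_smul] at h
    exact h.const_add M
  have hA : HasDerivAt (fun t : ℝ => primitive f (M + t • M)) (fderiv ℝ (primitive f) M M) 0 :=
    (hasFDerivAt_primitive hf hM).differentiableAt.hasFDerivAt.comp_hasDerivAt_of_eq 0 hγ
      (by simp)
  have heq : (fun t : ℝ => primitive f (M + t • M)) =ᶠ[𝓝 0] fun _ => primitive f M := by
    filter_upwards [Ioi_mem_nhds (show (-1 : ℝ) < 0 by norm_num)] with t ht
    have ht' : -1 < t := ht
    have h1 : M + t • M = ((1 + t : ℝ) : ℂ) • M := by
      rw [Complex.coe_smul, add_smul, one_smul]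
    rw [h1, primitive_smul f hM]
    exact ofReal_ne_zero.2 (by linarith)
  exact hA.unique ((hasDerivAt_const (0 : ℝ) (primitive f M)).congr_of_eventuallyEq heq)

/-! ### All right derivatives of the primitive -/

/-- The `𝔭₀`-component of `Z ∈ M₂(ℂ) = 𝔭₀ ⊕ ℝ · 1 ⊕ 𝔲(2)`, namely
`½ (Z + Zᴴ) − ½ Re(tr Z) · 1`, written through `tangentMap`. [folklore] -/
def htPart (Z : Mat) : Mat := Xof ((2⁻¹ : ℝ) • tangentMap Z)

/-- `htPart Z ∈ 𝔭₀`. [folklore] -/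
theorem isHT_htPart (Z : Mat) : IsHT (htPart Z) := isHT_Xof _

/-- `htPart` is the identity on `𝔭₀`. [folklore] -/
theorem htPart_of_isHT {X : Mat} (hX : IsHT X) : htPart X = X := by
  rw [htPart, tangentMap_of_isHerm hX.1 hX.2, smul_smul, inv_mul_cancel₀ two_ne_zero, one_smul,
    Xof_vof hX.1 hX.2]

/-- `htPart` is real-linear. [folklore] -/
theorem htPart_add (Z W : Mat) : htPart (Z + W) = htPart Z + htPart W := by
  ext i j
  fin_cases i <;> fin_cases j <;> simp [htPart, Xof, tangentMap] <;> ring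

/-- `htPart` is real-linear. [folklore] -/
theorem htPart_smul (a : ℝ) (Z : Mat) : htPart (a • Z) = a • htPart Z := by
  ext i j
  fin_cases i <;> fin_cases j <;> simp [htPart, Xof, tangentMap] <;> ring

/-- The `𝔲(2)`-component of `Z`: `Z − htPart Z − ½ Re(tr Z) · 1`. [folklore] -/
def skewPart (Z : Mat) : Mat := Z - htPart Z - (((Z 0 0).re + (Z 1 1).re) / 2 : ℝ) • (1 : Mat)

/-- `skewPart Z` is skew-Hermitian. [folklore] -/
theorem conjTranspose_skewPart (Z : Mat) : (skewPart Z)ᴴ = -skewPart Z := by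
  ext i j
  fin_cases i <;> fin_cases j <;> simp [skewPart, htPart, Xof, tangentMap, Complex.ext_iff]
  all_goals first | (constructor <;> ring) | ring

/-- The decomposition `Z = htPart Z + skewPart Z + ½ Re(tr Z) · 1`. [folklore] -/
theorem eq_htPart_add_skewPart_add (Z : Mat) :
    Z = htPart Z + skewPart Z + (((Z 0 0).re + (Z 1 1).re) / 2 : ℝ) • (1 : Mat) := by
  simp only [skewPart]
  abel

/-- **All right derivatives of the primitive**: `DF(M)(M Z) = f (htPart Z) (M)` — the
`𝔭₀`-component contributes `f`, the `𝔲(2)`- and central components nothing.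
[cite: Harder1987, §3.1] -/
theorem fderiv_primitive_mul_eq (hf : IsCochain f) {M : Mat} (hM : M ∈ Inv) (Z : Mat) :
    fderiv ℝ (primitive f) M (M * Z) = f (htPart Z) M := by
  have hsmul : fderiv ℝ (primitive f) M
      (M * ((((Z 0 0).re + (Z 1 1).re) / 2 : ℝ) • (1 : Mat))) = 0 := by
    rw [Matrix.mul_smul, Matrix.mul_one, map_smul, fderiv_primitive_self hf hM, smul_zero]
  conv_lhs => rw [eq_htPart_add_skewPart_add Z]
  rw [Matrix.mul_add, Matrix.mul_add, map_add, map_add, fderiv_primitive_mul hf hM (isHT_htPart Z),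
    fderiv_primitive_mul_skewHerm hf hM (conjTranspose_skewPart Z), hsmul, add_zero, add_zero]

/-- **All derivatives of the primitive** at an invertible `M`: `DF(M)(W) = f (htPart (M⁻¹ W)) (M)`.
[cite: Harder1987, §3.1] -/
theorem fderiv_primitive_apply (hf : IsCochain f) {M : Mat} (hM : M ∈ Inv) (W : Mat) :
    fderiv ℝ (primitive f) M W = f (htPart (M⁻¹ * W)) M := by
  have hW : W = M * (M⁻¹ * W) := by
    rw [← Matrix.mul_assoc, Matrix.mul_nonsing_inv M hM, Matrix.one_mul]
  conv_lhs => rw [hW]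
  exact fderiv_primitive_mul_eq hf hM _


end GL2C

end Literature.NumberTheory.Automorphic

end
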